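import Mathlib

/-!
# Crux `MonotoneSuffices` (stmt-PneNP-18026) — negative note: the two-slice obstruction (PROVED)

Strategist's census, §Negation, item 2(b). Write a detector as `C(x) = D(x, ¬x)` with `D` monotone. A
SUBSTITUTION monotonisation replaces the negated literals by monotone functions `y_e(x)`
(Berkowitz's pseudo-complements `Th_m(x - x_e)`, thresholds of sub-sums, fixed paddings/maskings, …). For the
resulting monotone circuit `D(x, y(x))` to inherit the detector's guarantees by monotonicity of `D` one needs
`y(x) ≤ ¬x` where the TYPE-I error must be controlled and `y(x) ≥ ¬x` where the TYPE-II error must be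
controlled; and by slice-monotonicity of up-set densities an unconditional monotone detector obtained this
way must have its type-I error controlled on a slice ABOVE the bulk of `Bin(C(n,2), 1/2)` and its type-II
error controlled on a slice BELOW it (the sandwich lemma of the census). The theorem below shows that no
single monotone `y_e` can do both, on ANY two slices `m₁ < m₂` of any finite cube: monotone substitutes for
negation are low on low slices and high on high slices — the opposite of what two-sided detection across the
bulk needs. This is Tardos's phenomenon in miniature and is insensitive to the stochastic order of the
planted pair; it is why the registered line `Lines/slice_transport.lean` does not glue slices but transports
the pair to ONE slice and pays with a lower bound there.

Everything here is proved (no `sorry`); vocabulary: Mathlib only (`Finset`, Boolean cube `ι → Bool`).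
References: S. J. Berkowitz (1982) [Berkowitz1982]; S. Jukna, *Boolean Function Complexity* (2012),
§10.1–§10.2 (slice functions; Markov's theorem — `¬x_e` restricted to two comparable points already has
decrease 1) [Jukna2012]; É. Tardos (1988) [Tardos1988].
-/

set_option linter.dupNamespace false -- `Summit.PneNP.PneNP.…` is the layout-mandated namespace

namespace Summit.PneNP.PneNP.Cruxes.MonotoneSuffices.Negative

open Finset

variable {ι : Type*} [Fintype ι] [DecidableEq ι]

/-- The Hamming weight `|x|` of a point of the cube. -/
def weight (x : ι → Bool) : ℕ := (univ.filter fun i => x i = true).card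

/-- The indicator vector of a finite set. -/
def ind (S : Finset ι) : ι → Bool := fun i => decide (i ∈ S)

theorem weight_ind (S : Finset ι) : weight (ind S) = S.card := by
  unfold weight ind
  have : (univ.filter fun i => decide (i ∈ S) = true) = S := by ext i; simp
  rw [this]

omit [Fintype ι] in
theorem ind_le_ind {S U : Finset ι} (h : S ⊆ U) : ind S ≤ ind U := by
  intro i
  unfold ind
  by_cases hi : i ∈ S
  · have hU : i ∈ U := h hi
    simp [hi, hU]
  · simp [hi]

/-- **Two-slice obstruction.** On a finite cube, for slices `m₁ < m₂ ≤ |ι|` and a coordinate `e`, there is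
NO monotone Boolean function `y` that dominates `¬x_e` on the lower slice (`x_e = 0, |x| = m₁ ⇒ y x = 1`)
and is dominated by `¬x_e` on the upper slice (`x_e = 1, |x| = m₂ ⇒ y x = 0`). (Only the binding halves of
"`y ≥ ¬x_e` on slice `m₁`" and "`y ≤ ¬x_e` on slice `m₂`" are assumed, which makes the statement stronger.)
Proof: pick `S ⊆ ι ∖ {e}` with `|S| = m₁` and `U ⊇ S ∪ {e}` with `|U| = m₂`; then `1_S ≤ 1_U`, `y(1_S) = 1`,
`y(1_U) = 0`, contradicting monotonicity. -/
theorem no_two_slice_pseudoComplement (e : ι) {m₁ m₂ : ℕ} (h12 : m₁ < m₂) (h2 : m₂ ≤ Fintype.card ι)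
    (y : (ι → Bool) → Bool) (hy : Monotone y)
    (hlow : ∀ x : ι → Bool, weight x = m₁ → x e = false → y x = true)
    (hhigh : ∀ x : ι → Bool, weight x = m₂ → x e = true → y x = false) : False := by
  -- a set `S` avoiding `e` of size `m₁`
  have hcard : m₁ ≤ (univ.erase e).card := by
    rw [card_erase_of_mem (mem_univ e), card_univ]; omega
  obtain ⟨S, hSsub, hScard⟩ := exists_subset_card_eq hcard
  have heS : e ∉ S := fun he => by simpa using hSsub he
  -- a superset `U ⊇ insert e S` of size `m₂`
  have h1 : (insert e S).card ≤ m₂ := by rw [card_insert_of_notMem heS]; omega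
  obtain ⟨U, hSU, -, hUcard⟩ :=
    exists_subsuperset_card_eq (subset_univ (insert e S)) h1 (by simpa using h2)
  have hxlow : y (ind S) = true := hlow _ (by rw [weight_ind, hScard]) (by simp [ind, heS])
  have hxhigh : y (ind U) = false :=
    hhigh _ (by rw [weight_ind, hUcard]) (by simp [ind, hSU (mem_insert_self e S)])
  have hmono : y (ind S) ≤ y (ind U) := hy (ind_le_ind ((subset_insert e S).trans hSU))
  rw [hxlow, hxhigh] at hmono
  exact absurd hmono (by decide)

/-- Vector form: no family of monotone pseudo-complements `y_e` is `≥ ¬x` on slice `m₁` and `≤ ¬x` on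
slice `m₂` (coordinatewise), as soon as the cube is nonempty-dimensional and `m₁ < m₂ ≤ |ι|`. -/
theorem no_two_slice_pseudoComplements [Nonempty ι] {m₁ m₂ : ℕ} (h12 : m₁ < m₂) (h2 : m₂ ≤ Fintype.card ι)
    (y : ι → (ι → Bool) → Bool) (hy : ∀ e, Monotone (y e))
    (hlow : ∀ (e : ι) (x : ι → Bool), weight x = m₁ → (!x e) ≤ y e x)
    (hhigh : ∀ (e : ι) (x : ι → Bool), weight x = m₂ → y e x ≤ (!x e)) : False := by
  obtain ⟨e⟩ := ‹Nonempty ι›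
  refine no_two_slice_pseudoComplement e h12 h2 (y e) (hy e) (fun x hx hxe => ?_) (fun x hx hxe => ?_)
  · have := hlow e x hx
    rw [hxe] at this
    exact Bool.eq_true_of_true_le this
  · have := hhigh e x hx
    rw [hxe] at this
    simpa [Bool.le_iff_imp] using this

end Summit.PneNP.PneNP.Cruxes.MonotoneSuffices.Negative
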